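import Literature.Analysis.Complex.PQTypeZeroHolomorphic
import Literature.Analysis.Complex.PQPullback
import HarnessLib

/-!
# `∂̄`-closed flat `(p,0)`-forms are exactly the holomorphic maps (Huybrechts, Prop. 2.6.11, flat form)

For a finite-dimensional complex normed space `E`, an open `U ⊆ E` and a map
`F : E → E [⋀^Fin k]→L[ℝ] ℂ` with values of pointwise type `(p,0)` on `U`
(`Literature.Analysis.Complex.IsOfTypeAt`, the `ℂ`-multilinear alternating forms read as real
forms), the flat `∂̄`-operator is `x ↦ (dF)^{p,1}(x) = typeProjAt p 1 (extDeriv F x)`. We prove the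
two halves of "a `(p,0)`-form `u` with `∂̄u = 0` has holomorphic coefficients" (L. Hörmander, *An
Introduction to Complex Analysis in Several Variables* (1973), §2.1, after (2.1.5); D. Huybrechts,
*Complex Geometry* (2005), Prop. 2.6.11 `H⁰(X, Ω^p) = {α ∈ A^{p,0}(X) | ∂̄α = 0}`):

* `typeProjAt_extDeriv_eq_zero_of_differentiableOn_complex` — if `F` is complex-differentiable
  on `U` then `(dF)^{p,1} = 0` on `U`: `dF(x)` is the alternatisation of the `ℂ`-linear `DF(x)`,
  whose values have type `(p,0)`, hence has type `(p+1,0)` (`isOfTypeAt_alternatizeUncurryFin`);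
* `differentiableOn_complex_of_typeProjAt_extDeriv_eq_zero` — conversely, a real-differentiable
  `F` of type `(p,0)` on `U` with `(dF)^{p,1} = 0` on `U` is complex-differentiable on `U`: the
  tree's coordinate statement `Literature.Analysis.Complex.differentiableOn_complex_of_typeZero`
  (on `ℂ^ι`) transported along a `ℂ`-linear isomorphism `(Fin n → ℂ) ≃L[ℂ] E` with the flat
  pull-back calculus of `PQPullback` (`typeProjAt_extDeriv_flatPullback`,
  `IsOfTypeAt.flatPullback`).

Everything is proved; no definitions.

## References

* L. Hörmander, *An Introduction to Complex Analysis in Several Variables* (1973), §2.1.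
  [HormanderSCV1973]
* D. Huybrechts, *Complex Geometry* (2005), Prop. 2.6.11. [HuybrechtsCG2005]
-/

noncomputable section

open scoped Topology ContDiff
open Set Filter Function Complex ContinuousAlternatingMap

namespace Literature.Analysis.Complex

variable {E : Type*} [NormedAddCommGroup E] [NormedSpace ℂ E] {k : ℕ}

/-! ### Holomorphic maps have `∂̄ = 0` -/

/-- **The alternatisation of a `ℂ`-linear map with values of type `(p,0)` has type `(p+1,0)`.**
[cite: HuybrechtsCG2005, Prop. 1.2.8] -/
theorem isOfTypeAt_alternatizeUncurryFin {p : ℕ} {f : E →L[ℝ] E [⋀^Fin k]→L[ℝ] ℂ}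
    (hlin : ∀ (c : ℂ) (w : E), f (c • w) = c • f w) (hval : ∀ w, IsOfTypeAt p 0 (f w)) :
    IsOfTypeAt (p + 1) 0 (alternatizeUncurryFin f) := by
  have hpk : p + 0 = k := (hval 0).1
  refine ⟨by omega, fun θ v ↦ ?_⟩
  rw [alternatizeUncurryFin_apply, alternatizeUncurryFin_apply, Finset.mul_sum]
  refine Finset.sum_congr rfl fun i _ ↦ ?_
  have h1 : f (exp (θ * I) • v i) = exp (θ * I) • f (v i) := hlin _ _
  have h2 : (i.removeNth fun j ↦ exp (θ * I) • v j) = fun j ↦ exp (θ * I) • i.removeNth v j := rfl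
  rw [h1, h2, ContinuousAlternatingMap.smul_apply, (hval (v i)).2 θ (i.removeNth v)]
  simp only [smul_eq_mul]
  push_cast
  rw [show ((p : ℂ) + 1 - 0) * θ * I = θ * I + ((p : ℂ) - 0) * θ * I by ring, Complex.exp_add]
  ring

/-- The derivative of a map with values of type `(p,0)` on an open set has values of type `(p,0)`
(the `(p,0)`-forms form a closed `ℂ`-subspace, fixed by the continuous projection `typeProjL`).
[folklore] -/
theorem isOfTypeAt_fderiv_apply {p : ℕ} {F : E → E [⋀^Fin k]→L[ℝ] ℂ} {U : Set E} (hU : IsOpen U)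
    (ht : ∀ y ∈ U, IsOfTypeAt p 0 (F y)) {x : E} (hx : x ∈ U) (hF : DifferentiableAt ℝ F x) (w : E) :
    IsOfTypeAt p 0 (fderiv ℝ F x w) := by
  have hpk : p + 0 = k := (ht x hx).1
  -- `P ∘ F = F` near `x`
  set P : (E [⋀^Fin k]→L[ℝ] ℂ) →L[ℝ] (E [⋀^Fin k]→L[ℝ] ℂ) := (typeProjL p 0).restrictScalars ℝ with hP
  have hPF : (fun y ↦ P (F y)) =ᶠ[𝓝 x] F := by
    filter_upwards [hU.mem_nhds hx] with y hy
    rw [hP, ContinuousLinearMap.coe_restrictScalars', typeProjL_apply]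
    exact (ht y hy).typeProjAt_eq_self
  have h1 : fderiv ℝ (fun y ↦ P (F y)) x = P.comp (fderiv ℝ F x) := (P.hasFDerivAt.comp x hF.hasFDerivAt).fderiv
  have h2 : fderiv ℝ (fun y ↦ P (F y)) x = fderiv ℝ F x := hPF.fderiv_eq
  have h3 : P (fderiv ℝ F x w) = fderiv ℝ F x w := by
    have := congrArg (fun L : E →L[ℝ] (E [⋀^Fin k]→L[ℝ] ℂ) ↦ L w) (h1.symm.trans h2)
    simpa using this
  rw [hP, ContinuousLinearMap.coe_restrictScalars', typeProjL_apply] at h3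
  exact (isOfTypeAt_iff_typeProjAt_eq_self hpk _).2 h3

/-- **Holomorphic `(p,0)`-forms are `∂̄`-closed (flat form)**: if `F` is complex-differentiable on
the open `U` with values of type `(p,0)` there, then `(dF)^{p,1}(x) = typeProjAt p 1 (extDeriv F x)
= 0` for `x ∈ U`. Huybrechts (2005), Prop. 2.6.11 (⊇); Hörmander (1973), §2.1.
[cite: HuybrechtsCG2005, Prop. 2.6.11] -/
theorem typeProjAt_extDeriv_eq_zero_of_differentiableOn_complex {p : ℕ} {F : E → E [⋀^Fin k]→L[ℝ] ℂ}
    {U : Set E} (hU : IsOpen U) (hF : DifferentiableOn ℂ F U) (ht : ∀ y ∈ U, IsOfTypeAt p 0 (F y))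
    {x : E} (hx : x ∈ U) : typeProjAt p 1 (extDeriv F x) = 0 := by
  have hFx : DifferentiableAt ℂ F x := hF.differentiableAt (hU.mem_nhds hx)
  have hFxr : DifferentiableAt ℝ F x := hFx.restrictScalars ℝ
  -- the real derivative is the complex one, hence `ℂ`-linear
  have hfd : fderiv ℝ F x = (fderiv ℂ F x).restrictScalars ℝ := (hFx.hasFDerivAt.restrictScalars ℝ).fderiv
  have hlin : ∀ (c : ℂ) (w : E), fderiv ℝ F x (c • w) = c • fderiv ℝ F x w := fun c w ↦ by
    rw [hfd, ContinuousLinearMap.coe_restrictScalars', map_smul]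
  have htype : IsOfTypeAt (p + 1) 0 (extDeriv F x) :=
    isOfTypeAt_alternatizeUncurryFin hlin (isOfTypeAt_fderiv_apply hU ht hx hFxr)
  exact htype.typeProjAt_of_ne (by omega)

/-! ### `∂̄`-closed `(p,0)`-forms are holomorphic -/

/-- Pull-back of flat forms along a continuous linear map is `ℂ`-linear in the form. Duplicate
of `smul_compContinuousLinearMap_complex` (`PQPullback`, in the import closure); deprecated
restatement (dedup-01135, 2026-08-16). [folklore] -/
@[deprecated smul_compContinuousLinearMap_complex (since := "2026-08-16")]
theorem compContinuousLinearMap_smul_complex {E' : Type*} [NormedAddCommGroup E']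
    [NormedSpace ℂ E'] (L : E' →L[ℝ] E) (c : ℂ) (a : E [⋀^Fin k]→L[ℝ] ℂ) :
    (c • a).compContinuousLinearMap L = c • a.compContinuousLinearMap L :=
  smul_compContinuousLinearMap_complex c a L

/-- A map `x ↦ (G x).compContinuousLinearMap L`, with `G` complex-differentiable, is
complex-differentiable (post-composition with a `ℂ`-linear continuous map). [folklore] -/
theorem DifferentiableWithinAt.compContinuousLinearMap_const {E' X : Type*} [NormedAddCommGroup E']
    [NormedSpace ℂ E'] [NormedAddCommGroup X] [NormedSpace ℂ X] {G : X → E [⋀^Fin k]→L[ℝ] ℂ}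
    {s : Set X} {x : X} (hG : DifferentiableWithinAt ℂ G s x) (L : E' →L[ℝ] E) :
    DifferentiableWithinAt ℂ (fun y ↦ (G y).compContinuousLinearMap L) s x := by
  -- the `ℂ`-linear continuous map `a ↦ a ∘ L`
  let Λ : (E [⋀^Fin k]→L[ℝ] ℂ) →L[ℂ] (E' [⋀^Fin k]→L[ℝ] ℂ) :=
    { toFun := fun a ↦ a.compContinuousLinearMap L
      map_add' := fun a b ↦ by ext v; simp
      map_smul' := fun c a ↦ smul_compContinuousLinearMap_complex c a L
      cont := (ContinuousAlternatingMap.compContinuousLinearMapCLM L).continuous }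
  exact Λ.differentiableAt.comp_differentiableWithinAt x hG

/-- **`∂̄`-closed `(p,0)`-forms are holomorphic (flat form, any finite-dimensional `E`)**: a map
`F : E → Λ^k`, real-differentiable on the open `U`, with values of type `(p,0)` on `U` and
`(dF)^{p,1} = 0` on `U`, is complex-differentiable on `U`. Hörmander (1973), §2.1 ("`∂̄u = 0` for a
`(p,0)`-form means holomorphic coefficients"); Huybrechts (2005), Prop. 2.6.11 (⊆). Proof: the
tree's coordinate statement `differentiableOn_complex_of_typeZero` on `ℂⁿ`, transported along a
`ℂ`-linear isomorphism `ℂⁿ ≃ E` by the flat pull-back calculus. [cite: HormanderSCV1973, §2.1] -/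
theorem differentiableOn_complex_of_typeProjAt_extDeriv_eq_zero [FiniteDimensional ℂ E] {p : ℕ}
    {F : E → E [⋀^Fin k]→L[ℝ] ℂ} {U : Set E} (hU : IsOpen U) (hd : DifferentiableOn ℝ F U)
    (ht : ∀ y ∈ U, IsOfTypeAt p 0 (F y)) (hc : ∀ x ∈ U, typeProjAt p 1 (extDeriv F x) = 0) :
    DifferentiableOn ℂ F U := by
  classical
  have hpk : ∀ y ∈ U, p + 0 = k := fun y hy ↦ (ht y hy).1
  -- cut `F` off to `U` so that its values have type `(p,0)` everywhere
  set F' : E → E [⋀^Fin k]→L[ℝ] ℂ := fun y ↦ if y ∈ U then F y else 0 with hF'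
  have hFF' : ∀ y ∈ U, F' y = F y := fun y hy ↦ by simp [hF', hy]
  have hev : ∀ x ∈ U, F' =ᶠ[𝓝 x] F := fun x hx ↦ by
    filter_upwards [hU.mem_nhds hx] with y hy using hFF' y hy
  suffices h : DifferentiableOn ℂ F' U from h.congr fun y hy ↦ (hFF' y hy).symm
  have hd' : DifferentiableOn ℝ F' U := hd.congr fun y hy ↦ hFF' y hy
  rcases (U : Set E).eq_empty_or_nonempty with hUe | ⟨y₀, hy₀⟩
  · rw [hUe]; exact differentiableOn_empty
  have ht' : ∀ y, IsOfTypeAt p 0 (F' y) := fun y ↦ by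
    by_cases hy : y ∈ U
    · rw [hFF' y hy]; exact ht y hy
    · simp only [hF', hy, if_false]; exact isOfTypeAt_zero (hpk y₀ hy₀)
  have hc' : ∀ x ∈ U, typeProjAt p 1 (extDeriv F' x) = 0 := fun x hx ↦ by
    rw [(hev x hx).extDeriv_eq]; exact hc x hx
  -- coordinates
  set n := Module.finrank ℂ E
  let Φ : (Fin n → ℂ) ≃L[ℂ] E := (ContinuousLinearEquiv.ofFinrankEq (by simp [n])).symm
  have hΦd : ∀ z, DifferentiableAt ℂ (Φ : (Fin n → ℂ) → E) z := fun z ↦ Φ.differentiableAt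
  have hΦs : ∀ z, ContDiffAt ℝ ∞ (Φ : (Fin n → ℂ) → E) z := fun z ↦
    ((Φ : (Fin n → ℂ) →L[ℂ] E).restrictScalars ℝ).contDiff.contDiffAt
  -- the pulled-back form on `Φ⁻¹ U`
  set V : Set (Fin n → ℂ) := Φ ⁻¹' U with hV
  have hVo : IsOpen V := hU.preimage Φ.continuous
  set δ := flatPullback (Φ : (Fin n → ℂ) → E) F' with hδ
  have hδd : DifferentiableOn ℝ δ V := by
    intro z hz
    have h1 : DifferentiableAt ℝ F' (Φ z) := hd'.differentiableAt (hU.mem_nhds hz)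
    have h2 : DifferentiableAt ℝ (fun w ↦ F' (Φ w)) z := h1.comp z ((hΦd z).restrictScalars ℝ)
    have h3 : (fun w ↦ fderiv ℝ (Φ : (Fin n → ℂ) → E) w) = fun _ ↦ ((Φ : (Fin n → ℂ) →L[ℂ] E).restrictScalars ℝ) := by
      funext w
      exact ((Φ : (Fin n → ℂ) →L[ℂ] E).restrictScalars ℝ).fderiv
    have h4 : δ = fun w ↦ (F' (Φ w)).compContinuousLinearMap (((Φ : (Fin n → ℂ) →L[ℂ] E).restrictScalars ℝ)) := by
      funext w; rw [hδ, flatPullback_apply, ← congrFun h3 w]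
    rw [h4]
    exact ((ContinuousAlternatingMap.compContinuousLinearMapCLM
      (((Φ : (Fin n → ℂ) →L[ℂ] E).restrictScalars ℝ))).differentiableAt.comp z h2).differentiableWithinAt
  have hδt : ∀ z, IsOfTypeAt p 0 (δ z) := fun z ↦ (ht' (Φ z)).flatPullback (hΦd z)
  have hδc : ∀ z ∈ V, typeProjAt p 1 (extDeriv δ z) = 0 := fun z hz ↦ by
    rw [hδ, typeProjAt_extDeriv_flatPullback p 1 (hd'.differentiableAt (hU.mem_nhds hz)) (hΦs z) (hΦd z),
      hc' (Φ z) hz]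
    exact (ContinuousAlternatingMap.compContinuousLinearMapₗ (fderiv ℝ (Φ : (Fin n → ℂ) → E) z)).map_zero
  have hδhol : DifferentiableOn ℂ δ V := differentiableOn_complex_of_typeZero hVo hδd hδt hδc
  -- back to `E`: `F' y = (δ (Φ⁻¹ y)) ∘ Φ⁻¹`
  have hback : ∀ y, F' y = (δ (Φ.symm y)).compContinuousLinearMap
      (((Φ.symm : E →L[ℂ] (Fin n → ℂ))).restrictScalars ℝ) := fun y ↦ by
    rw [hδ, flatPullback_apply,
      show fderiv ℝ (Φ : (Fin n → ℂ) → E) (Φ.symm y) = ((Φ : (Fin n → ℂ) →L[ℂ] E).restrictScalars ℝ) from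
        ((Φ : (Fin n → ℂ) →L[ℂ] E).restrictScalars ℝ).fderiv]
    ext v
    simp only [compContinuousLinearMap_apply, comp_def, ContinuousLinearMap.coe_restrictScalars',
      ContinuousLinearEquiv.coe_coe, ContinuousLinearEquiv.apply_symm_apply]
  intro y hy
  have hz : Φ.symm y ∈ V := by simp [hV, hy]
  have h1 : DifferentiableWithinAt ℂ (fun y ↦ δ (Φ.symm y)) U y :=
    (hδhol _ hz).comp y Φ.symm.differentiableWithinAt fun w hw ↦ by simp [hV, hw]
  have h2 := DifferentiableWithinAt.compContinuousLinearMap_const h1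
    (((Φ.symm : E →L[ℂ] (Fin n → ℂ))).restrictScalars ℝ)
  exact h2.congr (fun w _ ↦ hback w) (hback y)

end Literature.Analysis.Complex

end
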